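import Summits.ValiantsHypothesis.ValiantsHypothesis.Theorems.MonotoneRestorationOrbitRestorationQPValueDerivation
import HarnessLib

/-!
# Operations on value derivations: union, adjoining steps (symmetrisation in ORBIT currency, VII-a)

Route MonotoneRestoration, crux `OrbitRestorationQP` (stmt-ValiantsHypothesis-18293), namespace
`Summit.ValiantsHypothesis.ValiantsHypothesis.Theorems.ValueDerivation`.  Route-independent infrastructure
(no `Theses` import).

Value derivations (`…ValueDerivation.lean`) are merged as SETS of values — unlike symmetric circuits, whose
naive combination can create automorphisms and blow up the orbit size `ORB` (g0's wall W1):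

* `union` (the second derivation stacked above the first; `mem_union_S`), `adjoin` (one step whose operands
  are values; `mem_adjoin_S`), `addStep` / `mulStep` / `smulStep` (sum, product, scalar multiple of values).

Use the `mem_…` lemmas at concrete coefficient types: the underlying `Finset` operations are taken with the
classical decidability instances.  Everything is proved. [folklore]
-/

noncomputable section

open scoped Classical

-- `Summit.ValiantsHypothesis.ValiantsHypothesis.…` is the tree's single-conjunct layout (Sub = Summit).
set_option linter.dupNamespace false

namespace Summit.ValiantsHypothesis.ValiantsHypothesis.Theorems

universe u v

namespace ValueDerivation

variable {K : Type u} {X : Type v} [Field K]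

/-- The largest rank of a value. [folklore] -/
def maxRank (𝒟 : ValueDerivation K X) : ℕ := 𝒟.S.sup 𝒟.rank

/-- Ranks are bounded by `maxRank`. [folklore] -/
theorem rank_le_maxRank (𝒟 : ValueDerivation K X) {q : MvPolynomial X K} (hq : q ∈ 𝒟.S) :
    𝒟.rank q ≤ 𝒟.maxRank := Finset.le_sup (f := 𝒟.rank) hq

/-- **Union of two value derivations** (the second stacked above the first). [folklore] -/
def union (𝒟₁ 𝒟₂ : ValueDerivation K X) : ValueDerivation K X where
  S := 𝒟₁.S ∪ 𝒟₂.S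
  rank := fun q => if q ∈ 𝒟₁.S then 𝒟₁.rank q else 𝒟₁.maxRank + 1 + 𝒟₂.rank q
  step := by
    intro q hq
    by_cases h1 : q ∈ 𝒟₁.S
    · obtain ⟨d, hd⟩ := 𝒟₁.step q h1
      refine ⟨d, ⟨hd.value_eq, fun u hu => ?_⟩⟩
      obtain ⟨huS, hlt⟩ := hd.args_lt u hu
      refine ⟨Finset.mem_union_left _ huS, ?_⟩
      simp only [if_pos huS, if_pos h1]
      exact hlt
    · have h2 : q ∈ 𝒟₂.S := (Finset.mem_union.1 hq).resolve_left h1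
      obtain ⟨d, hd⟩ := 𝒟₂.step q h2
      refine ⟨d, ⟨hd.value_eq, fun u hu => ?_⟩⟩
      obtain ⟨huS, hlt⟩ := hd.args_lt u hu
      refine ⟨Finset.mem_union_right _ huS, ?_⟩
      simp only [if_neg h1]
      by_cases hu1 : u ∈ 𝒟₁.S
      · rw [if_pos hu1]
        have := 𝒟₁.rank_le_maxRank hu1
        omega
      · rw [if_neg hu1]
        omega

/-- Membership in the values of a union (use this, not the `Finset` union, at concrete coefficient types:
the union is taken with the classical decidability instances). [folklore] -/
theorem mem_union_S {𝒟₁ 𝒟₂ : ValueDerivation K X} {r : MvPolynomial X K} :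
    r ∈ (𝒟₁.union 𝒟₂).S ↔ r ∈ 𝒟₁.S ∨ r ∈ 𝒟₂.S := Finset.mem_union

/-- Left values are values of the union. [folklore] -/
theorem mem_union_S_left {𝒟₁ 𝒟₂ : ValueDerivation K X} {r : MvPolynomial X K} (h : r ∈ 𝒟₁.S) :
    r ∈ (𝒟₁.union 𝒟₂).S := mem_union_S.2 (Or.inl h)

/-- Right values are values of the union. [folklore] -/
theorem mem_union_S_right {𝒟₁ 𝒟₂ : ValueDerivation K X} {r : MvPolynomial X K} (h : r ∈ 𝒟₂.S) :
    r ∈ (𝒟₁.union 𝒟₂).S := mem_union_S.2 (Or.inr h)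

/-- **Adjoining one step** whose operands are already values. [folklore] -/
def adjoin (𝒟 : ValueDerivation K X) (d : StepData K X) (hd : ∀ u ∈ d.args, u ∈ 𝒟.S) :
    ValueDerivation K X where
  S := insert d.value 𝒟.S
  rank := fun q => if q ∈ 𝒟.S then 𝒟.rank q else 𝒟.maxRank + 1
  step := by
    intro q hq
    by_cases h1 : q ∈ 𝒟.S
    · obtain ⟨d', hd'⟩ := 𝒟.step q h1
      refine ⟨d', ⟨hd'.value_eq, fun u hu => ?_⟩⟩
      obtain ⟨huS, hlt⟩ := hd'.args_lt u hu
      refine ⟨Finset.mem_insert_of_mem huS, ?_⟩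
      simp only [if_pos huS, if_pos h1]
      exact hlt
    · have hq' : q = d.value := (Finset.mem_insert.1 hq).resolve_right h1
      refine ⟨d, ⟨hq'.symm, fun u hu => ⟨Finset.mem_insert_of_mem (hd u hu), ?_⟩⟩⟩
      simp only [if_pos (hd u hu), if_neg h1]
      exact Nat.lt_succ_of_le (𝒟.rank_le_maxRank (hd u hu))

/-- Membership in the values after adjoining (classical decidability inside; use this lemma at concrete
coefficient types). [folklore] -/
theorem mem_adjoin_S {𝒟 : ValueDerivation K X} {d : StepData K X} {hd : ∀ u ∈ d.args, u ∈ 𝒟.S}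
    {r : MvPolynomial X K} : r ∈ (𝒟.adjoin d hd).S ↔ r = d.value ∨ r ∈ 𝒟.S := Finset.mem_insert

/-- The adjoined value is a value. [folklore] -/
theorem value_mem_adjoin_S {𝒟 : ValueDerivation K X} {d : StepData K X} {hd : ∀ u ∈ d.args, u ∈ 𝒟.S} :
    d.value ∈ (𝒟.adjoin d hd).S := mem_adjoin_S.2 (Or.inl rfl)

/-- Adjoining the sum of two values. [folklore] -/
def addStep (𝒟 : ValueDerivation K X) (p q : MvPolynomial X K) (hp : p ∈ 𝒟.S) (hq : q ∈ 𝒟.S) :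
    ValueDerivation K X :=
  𝒟.adjoin (StepData.sum ((1, p) ::ₘ {(1, q)})) (by
    intro u hu
    simp only [StepData.args, Multiset.map_cons, Multiset.map_singleton, Multiset.mem_cons,
      Multiset.mem_singleton] at hu
    rcases hu with rfl | rfl
    · exact hp
    · exact hq)

/-- Membership in the values after adjoining a sum. [folklore] -/
theorem mem_addStep_S {𝒟 : ValueDerivation K X} {p q : MvPolynomial X K} {hp : p ∈ 𝒟.S} {hq : q ∈ 𝒟.S}
    {r : MvPolynomial X K} : r ∈ (𝒟.addStep p q hp hq).S ↔ r = p + q ∨ r ∈ 𝒟.S := by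
  have hv : (StepData.sum ((1, p) ::ₘ {(1, q)}) : StepData K X).value = p + q := by simp [StepData.value]
  rw [addStep, mem_adjoin_S, hv]

/-- Adjoining the product of two values. [folklore] -/
def mulStep (𝒟 : ValueDerivation K X) (p q : MvPolynomial X K) (hp : p ∈ 𝒟.S) (hq : q ∈ 𝒟.S) :
    ValueDerivation K X :=
  𝒟.adjoin (StepData.prod p q) (by
    intro u hu
    simp only [StepData.args, Multiset.insert_eq_cons, Multiset.mem_cons, Multiset.mem_singleton] at hu
    rcases hu with rfl | rfl
    · exact hp
    · exact hq)

/-- Membership in the values after adjoining a product. [folklore] -/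
theorem mem_mulStep_S {𝒟 : ValueDerivation K X} {p q : MvPolynomial X K} {hp : p ∈ 𝒟.S} {hq : q ∈ 𝒟.S}
    {r : MvPolynomial X K} : r ∈ (𝒟.mulStep p q hp hq).S ↔ r = p * q ∨ r ∈ 𝒟.S := by
  rw [mulStep, mem_adjoin_S]
  rfl

/-- Adjoining a scalar multiple of a value. [folklore] -/
def smulStep (𝒟 : ValueDerivation K X) (a : K) (p : MvPolynomial X K) (hp : p ∈ 𝒟.S) :
    ValueDerivation K X :=
  𝒟.adjoin (StepData.sum {(a, p)}) (by
    intro u hu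
    simp only [StepData.args, Multiset.map_singleton, Multiset.mem_singleton] at hu
    rw [hu]
    exact hp)

/-- Membership in the values after adjoining a scalar multiple. [folklore] -/
theorem mem_smulStep_S {𝒟 : ValueDerivation K X} {a : K} {p : MvPolynomial X K} {hp : p ∈ 𝒟.S}
    {r : MvPolynomial X K} : r ∈ (𝒟.smulStep a p hp).S ↔ r = MvPolynomial.C a * p ∨ r ∈ 𝒟.S := by
  have hv : (StepData.sum {(a, p)} : StepData K X).value = MvPolynomial.C a * p := by simp [StepData.value]
  rw [smulStep, mem_adjoin_S, hv]

end ValueDerivation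

end Summit.ValiantsHypothesis.ValiantsHypothesis.Theorems

end
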